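import Summits.ResolutionOfSingularities.ResolutionOfSingularities.Theorems.HilbertSamuelEliminationSigmaMaxModificationsCorridor3SigmaTameLowLaws
import HarnessLib

/-!
# [OURS · L1 W4.2] σ-LAYER, TAME-LOW row T-L6, supplement — `Corridor3SigmaTameLowLawsIn`: the CODOMAIN-PARAMETRIC form of the T-L6 fuel and socket.
# res-D-pv-002's assembly became codomain-parametric (p567247 `GroupRankReadingAny.assembleIn` / `hybridEliminationHyp3S_of_kindReadingsIn`; ACK 2026-08-27T20:42:58Z):
# the TAME-LOW supplier builds its rank reading in the NATIVE codomain `ℕ ×ₗ (Δ ×ₗ Colex((ℕ ×ₗ ℕ) →₀ ℕ))` with `Δ` = res-L1-w42-stub-4's snc rank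
# (`sncRank : ℕ ×ₗ (ℕ ×ₗ ℕ)` = (Σδ of singular branches, pairDefect, crowding), T-L4 p565370/p567030) instead of the `ℕ`-valued defect of RULING -48 (PD)(vi).
# This file restates `…TameLowLaws`' §2–§4 with the middle coordinate in ANY preorder `Δ`: `tameLowFuelIn`, `IsSncChildIn`, `IsEndChildIn`, `IsTameLowStepIn`,
# `HasStepWitnessIn`, `TameLowLineageIn Δ` and **`TameLowLineageIn.toRankReading : GroupRankReadingAny (ℕ ×ₗ (Δ ×ₗ Colex((ℕ ×ₗ ℕ) →₀ ℕ))) …`** — the `ρL`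
# of `…ofKindReadingsIn` with `Δ := ℕ ×ₗ (ℕ ×ₗ ℕ)`; the base-point-phase law (`IsPointChild.basePointCount_lt`, PROVED in `…TameLowLaws`) is reused verbatim
# (crux chain w42 `SigmaMaxModifications` stmt-ResolutionOfSingularities-18506 / conjunct `SigmaMaxModificationsCorridor3` stmt-ResolutionOfSingularities-19249;
# seat res-L1-type-o2 g9 = «res-type-067/068 SUCCESSOR»; `--supports stmt-ResolutionOfSingularities-19249 --as helper`, counted 0)

HONEST FRAMING. OURS bookkeeping; every `theorem` PROVED (lexicographic order algebra); the `structure … : Prop` readings are the σ-realisation's obligations exactly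
as in `…TameLowLaws` (rows T-L4 / T-L5 own their content). No named fact, no axiom, no instance, no notation. NOTHING here is a statement of H. Hironaka's
manuscript [Hironaka2017] nor of Cossart–Jannsen–Saito. AI-typed; AI review weaker than expert review.
-/

noncomputable section

set_option linter.dupNamespace false -- mandated namespace of this single-conjunct summit

open IsLocalRing Literature.AlgebraicGeometry.Resolution
open Summit.ResolutionOfSingularities.ResolutionOfSingularities.Theorems.CampaignW42

namespace Summit.ResolutionOfSingularities.ResolutionOfSingularities.Theorems.SigmaMaxModificationsCorridor3.Sigma.TameLow

universe u

/-- [OURS · L1 W4.2] The TAME-LOW fuel codomain with the middle (snc) coordinate in a preorder `Δ`. [folklore] -/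
abbrev TameLowFuelIn (Δ : Type) : Type := ℕ ×ₗ (Δ ×ₗ Colex ((ℕ ×ₗ ℕ) →₀ ℕ))

namespace CoeffDatum

variable {K : Type u} [Field K] {Δ : Type} [Preorder Δ]

/-- [OURS · L1 W4.2] **THE TAME-LOW FUEL, codomain-parametric**: `(#base points, δ, q)` with `δ : Δ` (stub-4's `sncRank` in the instance of record).
NOT a statement of the manuscript. [folklore] -/
def tameLowFuelIn (D : CoeffDatum K) (δ : Δ) (q : Colex ((ℕ ×ₗ ℕ) →₀ ℕ)) : TameLowFuelIn Δ := toLex (D.basePointCount, toLex (δ, q))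

/-- **Lex law 1**: fewer base points ⇒ smaller fuel. [folklore] -/
theorem tameLowFuelIn_lt_of_basePointCount_lt {D D' : CoeffDatum K} (h : D'.basePointCount < D.basePointCount) (δ δ' : Δ)
    (q q' : Colex ((ℕ ×ₗ ℕ) →₀ ℕ)) : D'.tameLowFuelIn δ' q' < D.tameLowFuelIn δ q :=
  Prod.Lex.toLex_lt_toLex.mpr (Or.inl h)

/-- **Lex law 2**: at equal base-point count, smaller snc rank ⇒ smaller fuel. [folklore] -/
theorem tameLowFuelIn_lt_of_snc_lt {D D' : CoeffDatum K} (h0 : D'.basePointCount = D.basePointCount) {δ δ' : Δ} (h : δ' < δ)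
    (q q' : Colex ((ℕ ×ₗ ℕ) →₀ ℕ)) : D'.tameLowFuelIn δ' q' < D.tameLowFuelIn δ q :=
  Prod.Lex.toLex_lt_toLex.mpr (Or.inr ⟨h0, Prod.Lex.toLex_lt_toLex.mpr (Or.inl h)⟩)

/-- **Lex law 3**: at equal first two coordinates, smaller `q2Measure` ⇒ smaller fuel. [folklore] -/
theorem tameLowFuelIn_lt_of_q_lt {D D' : CoeffDatum K} (h0 : D'.basePointCount = D.basePointCount) (δ : Δ) {q q' : Colex ((ℕ ×ₗ ℕ) →₀ ℕ)}
    (h : q' < q) : D'.tameLowFuelIn δ q' < D.tameLowFuelIn δ q :=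
  Prod.Lex.toLex_lt_toLex.mpr (Or.inr ⟨h0, Prod.Lex.toLex_lt_toLex.mpr (Or.inr ⟨rfl, h⟩)⟩)

/-- **Base-point phase** (PROVED law of `…TameLowLaws`): the fuel drops whatever `δ`, `q` do. [cite: ZariskiSamuel1960, Appendix 5] -/
theorem IsPointChild.tameLowFuelIn_lt {D D' : CoeffDatum K} (h : IsPointChild D D') (hne : D.residual ≠ ⊤) (δ δ' : Δ)
    (q q' : Colex ((ℕ ×ₗ ℕ) →₀ ℕ)) : D'.tameLowFuelIn δ' q' < D.tameLowFuelIn δ q :=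
  tameLowFuelIn_lt_of_basePointCount_lt (h.basePointCount_lt hne) δ δ' q q'

/-- [OURS · L1 W4.2] **READING AXIOM — SNC-PHASE STEP**, parametric `δ` (row T-L4: point child, `𝔞♮ = ⊤`, the snc rank DROPS — stub-4's
`sncRank (n+1) < sncRank n`). NOT a statement of the manuscript. [folklore] -/
structure IsSncChildIn (D D' : CoeffDatum K) (δ δ' : Δ) : Prop where
  /-- point blow-up of the lineage point with the controlled-transform law -/
  pointChild : IsPointChild D D'
  /-- base-point phase over -/
  residual_eq_top : D.residual = ⊤
  /-- the snc rank drops -/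
  snc_lt : δ' < δ

/-- Snc phase: equal (zero) base-point counts. [folklore] -/
theorem IsSncChildIn.basePointCount_eq {D D' : CoeffDatum K} {δ δ' : Δ} (h : IsSncChildIn D D' δ δ') : D'.basePointCount = D.basePointCount := by
  have h0 : D.basePointCount = 0 := D.basePointCount_eq_zero_iff.mpr h.residual_eq_top
  have h0' : D'.basePointCount = 0 := Nat.le_zero.mp (h0 ▸ h.pointChild.basePointCount_le)
  rw [h0, h0']

/-- **FUEL DROP in the snc phase** (parametric). [folklore] -/
theorem IsSncChildIn.tameLowFuelIn_lt {D D' : CoeffDatum K} {δ δ' : Δ} (h : IsSncChildIn D D' δ δ') (q q' : Colex ((ℕ ×ₗ ℕ) →₀ ℕ)) :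
    D'.tameLowFuelIn δ' q' < D.tameLowFuelIn δ q :=
  tameLowFuelIn_lt_of_snc_lt h.basePointCount_eq h.snc_lt q q'

/-- [OURS · L1 W4.2] **READING AXIOM — END-GAME STEP**, parametric `δ` (row T-L5: `𝔞♮ = ⊤` both sides, `q2Measure` drops). NOT a statement of the manuscript.
[folklore] -/
structure IsEndChildIn (D D' : CoeffDatum K) (δ : Δ) (q q' : Colex ((ℕ ×ₗ ℕ) →₀ ℕ)) : Prop where
  /-- base-point phase over at the parent -/
  residual_eq_top : D.residual = ⊤
  /-- … and at the child -/
  residual_eq_top' : D'.residual = ⊤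
  /-- the end-game measure drops -/
  q_lt : q' < q

/-- **FUEL DROP in the end-game** (parametric). [folklore] -/
theorem IsEndChildIn.tameLowFuelIn_lt {D D' : CoeffDatum K} {δ : Δ} {q q' : Colex ((ℕ ×ₗ ℕ) →₀ ℕ)} (h : IsEndChildIn D D' δ q q') :
    D'.tameLowFuelIn δ q' < D.tameLowFuelIn δ q := by
  refine tameLowFuelIn_lt_of_q_lt ?_ δ h.q_lt
  rw [D.basePointCount_eq_zero_iff.mpr h.residual_eq_top, D'.basePointCount_eq_zero_iff.mpr h.residual_eq_top']

/-- [OURS · L1 W4.2] **A TAME-LOW STEP**, parametric `δ`: one of the three phases. NOT a statement of the manuscript. [folklore] -/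
inductive IsTameLowStepIn : (D D' : CoeffDatum K) → (δ δ' : Δ) → (q q' : Colex ((ℕ ×ₗ ℕ) →₀ ℕ)) → Prop
  /-- base-point phase -/
  | basePoint {D D' : CoeffDatum K} {δ δ' : Δ} {q q' : Colex ((ℕ ×ₗ ℕ) →₀ ℕ)} (h : IsPointChild D D') (hne : D.residual ≠ ⊤) :
      IsTameLowStepIn D D' δ δ' q q'
  /-- snc phase -/
  | snc {D D' : CoeffDatum K} {δ δ' : Δ} {q q' : Colex ((ℕ ×ₗ ℕ) →₀ ℕ)} (h : IsSncChildIn D D' δ δ') : IsTameLowStepIn D D' δ δ' q q'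
  /-- end-game -/
  | endGame {D D' : CoeffDatum K} {δ : Δ} {q q' : Colex ((ℕ ×ₗ ℕ) →₀ ℕ)} (h : IsEndChildIn D D' δ q q') : IsTameLowStepIn D D' δ δ q q'

/-- **EVERY TAME-LOW STEP LOWERS THE FUEL** (parametric codomain). [folklore] -/
theorem tameLowFuelIn_lt_of_isTameLowStepIn {D D' : CoeffDatum K} {δ δ' : Δ} {q q' : Colex ((ℕ ×ₗ ℕ) →₀ ℕ)}
    (h : IsTameLowStepIn D D' δ δ' q q') : D'.tameLowFuelIn δ' q' < D.tameLowFuelIn δ q := by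
  cases h with
  | basePoint h hne => exact h.tameLowFuelIn_lt hne _ _ _ _
  | snc h => exact h.tameLowFuelIn_lt _ _
  | endGame h => exact h.tameLowFuelIn_lt

end CoeffDatum

/-! ## The thin σ-socket, codomain-parametric -/

section Socket

open Summit.ResolutionOfSingularities.ResolutionOfSingularities.Theorems.SigmaMaxModificationsCorridor3.Sigma

variable {G : Type} (Δ : Type) [Preorder Δ] (σ : StrategyE.{u}) (N : ℕ) (ν : ℕ → ℕ) (s₀ : MarkedStageE.{u}) (GLive : G → MarkedStageE.{u} → Prop)

/-- [OURS · L1 W4.2] A RING WITNESS between two fuels, parametric `Δ`. NOT a statement of the manuscript. [folklore] -/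
def HasStepWitnessIn (r r' : TameLowFuelIn Δ) : Prop :=
  ∃ (K : Type u) (_ : Field K) (D D' : CoeffDatum K) (δ δ' : Δ) (q q' : Colex ((ℕ ×ₗ ℕ) →₀ ℕ)),
    r = D.tameLowFuelIn δ q ∧ r' = D'.tameLowFuelIn δ' q' ∧ CoeffDatum.IsTameLowStepIn D D' δ δ' q q'

variable {Δ} in
/-- A witnessed step lowers the fuel. [folklore] -/
theorem lt_of_hasStepWitnessIn {r r' : TameLowFuelIn Δ} (h : HasStepWitnessIn.{u} Δ r r') : r' < r := by
  obtain ⟨K, _, D, D', δ, δ', q, q', rfl, rfl, hstep⟩ := h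
  exact CoeffDatum.tameLowFuelIn_lt_of_isTameLowStepIn hstep

/-- [OURS · L1 W4.2] **THE TAME-LOW LINEAGE READING, codomain-parametric** (`Δ` = stub-4's snc-rank codomain in the instance of record): rank, board-change and
adjacent-birth predicates, (W) every board-CHANGING live step witnessed, (I) other live steps keep the rank. NOT a statement of the manuscript. [folklore] -/
structure TameLowLineageIn where
  /-- the fuel of group `g` at stage `s` -/
  rank : MarkedStageE.{u} → G → TameLowFuelIn Δ
  /-- the step changes the board / germ of `g` -/
  changes : (ℕ → MarkedStageE.{u}) → G → ℕ → Prop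
  /-- an adjacent group is born at the step -/
  Adjacent : (ℕ → MarkedStageE.{u}) → G → ℕ → Prop
  /-- (W) board-changing live steps are witnessed -/
  witness : ∀ c, IsChainFromσE σ N ν s₀ c → ∀ g n, GLive g (c n) → GLive g (c (n + 1)) → changes c g n →
    HasStepWitnessIn.{u} Δ (rank (c n) g) (rank (c (n + 1)) g)
  /-- (I) other live steps do not move the rank -/
  rank_eq : ∀ c, IsChainFromσE σ N ν s₀ c → ∀ g n, GLive g (c n) → GLive g (c (n + 1)) → ¬ changes c g n →
    rank (c (n + 1)) g = rank (c n) g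

variable {Δ σ N ν s₀ GLive}

/-- **THE SOCKET, parametric**: a TAME-LOW lineage reading IS a rank reading in `ℕ ×ₗ (Δ ×ₗ Colex((ℕ ×ₗ ℕ) →₀ ℕ))` — the `ρL` of 002's
`GroupRankSimulation.ofKindReadingsIn` / `hybridEliminationHyp3S_of_kindReadingsIn` in the supplier's native codomain. [folklore] -/
def TameLowLineageIn.toRankReading (L : TameLowLineageIn Δ σ N ν s₀ GLive) : GroupRankReadingAny (TameLowFuelIn Δ) σ N ν s₀ GLive where
  rank := L.rank
  changes := L.changes
  Adjacent := L.Adjacent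
  move_lt c hc g n h₀ h₁ hch := lt_of_hasStepWitnessIn (L.witness c hc g n h₀ h₁ hch)
  neutral_le c hc g n h₀ h₁ hch _ := (L.rank_eq c hc g n h₀ h₁ hch).le
  seal_le c hc g n h₀ h₁ hch _ := (L.rank_eq c hc g n h₀ h₁ hch).le

/-- Unfolding. [folklore] -/
@[simp] theorem TameLowLineageIn.toRankReading_rank (L : TameLowLineageIn Δ σ N ν s₀ GLive) : L.toRankReading.rank = L.rank := rfl

/-- The codomain is well-founded when `Δ` is (so 002's descent applies; `Δ = ℕ ×ₗ (ℕ ×ₗ ℕ)` in the instance of record). [folklore] -/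
theorem wellFoundedLT_tameLowFuelIn [WellFoundedLT Δ] : WellFoundedLT (TameLowFuelIn Δ) := inferInstance

end Socket

end Summit.ResolutionOfSingularities.ResolutionOfSingularities.Theorems.SigmaMaxModificationsCorridor3.Sigma.TameLow

end
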